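import Summits.ABC.IUTFork.Cor312GenuineKDeepDatum
import Literature.IUT.LogVolume.GenuineRamificationBoundsPinned
import Literature.IUT.LogVolume.GenuineTowerDegreeBounds
import HarnessLib

/-!
# [IUTchIV] Thm. 1.10 Steps (ii)–(iii) at EVERY place over `p ∉ {2, 3, 5, l}` of the `l`-division field of a genuine
# Θ-volume datum: ABSOLUTE TAMENESS `p ∤ e(w|p)`, the sharp size `e(w|p) ≤ e(v₀|p)·46080·l`, and the exact different
# `d(K_w) = (e − 1)/e` (proof-only; abc-iut cell, D-0079 R-W «WINDOW Θ-SIDE INEQUALITY», lane U, seat abc-iut-w5-d157 gen 7)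

PROOF-ONLY support file (0 definitions, 0 `Prop` facts). TAKES NO SIDE on [IUTchIII] Cor. 3.12 (S. Mochizuki,
*Inter-universal Teichmüller theory III*, RIMS manuscript = PRIMS **57** (2021), Cor. 3.12 p. 173–174) or on any author:
classical algebraic number theory on the cell's typed Θ-volume data (`Cor22.ThetaVolumeDatumAt`, reading v3).

CONTEXT (R-W, plan/W/WINDOW-SPEC §3/§6; plan/rescue/R-W/README «ASSUMPTION A1»). The WINDOW-TABLE carries, per packet
(datum, bad prime `p`, place `w | p` of `K = T.K`, label `j`), the local columns `e_w`, `d_w`, `tame`; the per-datum engines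
(`Thm311.Real.not_licence_settingPrVolSharp_of_realises_explicit` p437756 / `…_of_explicitDepth` p439248 / abc-iut-C-cert-1's
`Conditional.GenuineK.not_pilotKummerCompatHull_chosen_of_explicit_depth` p438886) read `d + a + b` of the completion `K_w`.
abc-iut-c312-7's `Conditional.GenuineK.exists_bad_tame_place_of_ord_neg` / `GenuineK.exists_place_lamSeven` (p-ids of record in
HOME/STATUS) give ONE place `x₀ | p` with `p ∤ e`, `e ≤ e(v₀|p)·46080·l(l−1)²(l+1)`. THIS FILE gives the ∀-PLACE form with the
SHARP `K/F` layer, for EVERY genuine datum `T : Cor22.ThetaVolumeDatumAt P l` (`λ ∈ U_X`), EVERY prime `p ∉ {2, 3, 5, l}` and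
EVERY place `w | p` of `K`, under the one base hypothesis `p ∤ e(v₀|p)` at the place `v₀ = w ∩ F_tpd` (automatic at a
RATIONAL point, `F_tpd = ℚ`):

* `GenuineK.not_dvd_ramificationIdx_int_of_place` — **`p ∤ e(w|p)`** (ABSOLUTELY TAME): `e(w|p) = e(v₀|p)·e(v|v₀)·e(w|v)`
  (`v = w ∩ F`; abc-iut-w5-d009's `ThetaData.absRamificationIdx_eq_ramIdx_mul`) with `p ∤ e(v|v₀)` ("`F/F_tpd` tame away from
  `{2,3,5}`") and `p ∤ e(w|v)` ("`K/F` tame off `l`": `= 1` over the good places of `λ`, a power of `l` over the bad ones) —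
  conjuncts (ix), (vi), (vii) of abc-iut-S-d1/S3's `Cor22.ThetaVolumeDatumAt.towerFacts` ([IUTchIV] Thm. 1.10 Steps (ii)–(iii));
* `GenuineK.ramificationIdx_rel_dvd_of_place` — **`e(w|v) ∣ l`** at every `w ∤ l` (abc-iut-S1's `exists_ramificationIdx_eq_pow_of_ker_le`
  + `ramificationIdx_dvd_prime_of_eq_pow`: a power of `l` dividing `[K:F] ∣ l(l−1)²(l+1)`), the layer the ∃-form bounds by `[K:F]`;
* `GenuineK.ramificationIdx_int_le_of_place` — **`e(w|p) ≤ e(v₀|p)·46080·l`** (`e(v|v₀) ≤ 46080` at odd `v₀`: abc-iut-S1's two-root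
  lemma `Cor22.ramificationIdx_subThetaField_le`, Step (ii) `Gal(F/F_tpd) ↪ GL₂(𝔽₃)×GL₂(𝔽₅)×ℤ/2`); also
  `GenuineK.ramificationIdx_int_dvd_of_place`: `e(w|p) ∣ e(v₀|p)·(2¹²·3²·5)·l` (`e(v|v₀) ∣ [F:F_tpd] ∣ 2¹²·3²·5`, Galois);
* `GenuineK.not_dvd_absRamificationIdx_kOf` / `absRamificationIdx_kOf_le` / `differentOrd_kOf_eq` / `depthConstants_kOf_le` — the same
  at EVERY point `x₀` of the fibre over `p` of the index of `Cor312Prov.pilotDataOfK T.D T.K` (`kOf … p x₀ = K_w`, `w = placeOf x₀`;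
  abc-iut-S7's `absRamificationIdx_rescaledCompletion`): `p ∤ e(K_w/ℚ_p)`, `e ≤ e(v₀|p)·46080·l`, `d(K_w) = (e−1)/e` EXACTLY (Serre III §6
  Prop. 13: `differentOrd_eq_of_not_dvd`), `d + a + b ≤ 2 + log(e(v₀|p)·46080·l)/log p` (abc-iut-c312-7 F1
  `Cor312Prov.differentOrd_add_logRadius_le_of_not_dvd`).

USE (R-W): WINDOW-TABLE columns `d_w = (e_w − 1)/e_w`, «absolutely tame», `e_w ≤ e(v₀|p)·46080·l` as KERNEL facts for every
packet over `p ∉ {2,3,5,l}` (rational points: sequel `Cor312GenuineKTamePlacesRatPoint`); HEX-SHARP (spec §6 (1)(2)) gets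
`d + a + b ≤ 2 + log_7(46080·l)` at every `x₀ | 7`. HONEST FRAMING: bookkeeping over OUR typed objects; nothing here bears on the
printed inequality of [IUTchIII] Cor. 3.12, on `Cor22.Cor312AtDatum`, or on S_H itself; typed ≠ proved; instantiated ≠ endorsed.
[cite: Mochizuki2012, IUTchI Def. 3.1 (b),(c) p. 61–62; IUTchIV Prop. 1.8 (vii) p. 19, Thm. 1.10 Steps (ii)–(iii) p. 24–26]
[cite: NeukirchANT1999, Ch. I §8 Prop. (8.2), §9 Prop. (9.3); Ch. II Prop. (6.8)] [cite: SerreLocalFields1979, Ch. III §6 Prop. 13]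
[claim: Mochizuki2012, status: disputed] for every IUT quotation.
-/

noncomputable section

open NumberField IsDedekindDomain

namespace Summit.ABC.IUTFork.Conditional

open Thm311 Thm311.Real Cor312 Cor312Prov Literature.IUT.LogVolume Literature.IUT.HodgeTheaters
  Literature.IUT.LogThetaLattice Literature.NumberTheory.NumberFields Literature.NumberTheory.DiophantineGeometry.GenEll
  Literature.NumberTheory.EllipticCurves Literature.NumberTheory.GaloisRepresentations

variable {P : NFPoint} {l : ℕ} (T : Cor22.ThetaVolumeDatumAt P l)

/-! ## §1. Number-field level: every place `w | p` of `K`, `p ∉ {2, 3, 5, l}` -/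

/-- **`e(w|v) ∣ l` at EVERY place `w ∤ l` of `K` over `v = w ∩ F`** (for a genuine Θ-volume datum: `E_F` semistable with
`j = j(λ)`, `K` cut out by the `l`-torsion, `Gal(K/F) ↪ GL₂(𝔽_l)`): `e(w|v)` is a power of `l` ([IUTchIV] Prop. 1.8 (vii): `1`
at good places, `l^k` at multiplicative ones) dividing `[K:F] ∣ l(l−1)²(l+1)`, whose `l`-part is `l`.
[cite: Mochizuki2012, IUTchIV Prop. 1.8 (vii) p. 19, Thm. 1.10 Step (ii) p. 24] [cite: NeukirchANT1999, Ch. I §9 Prop. (9.3)] -/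
theorem GenuineK.ramificationIdx_rel_dvd_of_place
    (w : letI := T.instFieldK; letI := T.instNumberFieldK; HeightOneSpectrum (𝓞 T.K))
    (hwl : letI := T.instFieldK; letI := T.instNumberFieldK; residueChar T.K w ≠ l) :
    letI := T.instFieldF; letI := T.instNumberFieldF; letI := T.instFieldK; letI := T.instNumberFieldK
    letI := T.instAlgebraK
    w.asIdeal.ramificationIdx (𝓞 T.F) ∣ l := by
  letI := T.instFieldF; letI := T.instNumberFieldF; letI := T.instAlgebraF; letI := T.instFieldK
  letI := T.instNumberFieldK; letI := T.instAlgebraK; letI := T.instFieldFbar; letI := T.instAlgebraFbar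
  letI := T.instAlgebraKFbar; letI := T.instIsElliptic
  have hl : l.Prime := T.D.l_prime
  haveI : Fact l.Prime := ⟨hl⟩
  haveI := T.D.isScalarTower
  haveI := T.D.isAlgClosure
  haveI := T.D.isGalois_fieldOfModuli
  haveI : IsGalois T.F T.K := Cor22.isGalois_F_K_of_initialThetaData T.D
  -- the embedding `K → AlgebraicClosure F` inside the `l`-division field
  let ι : T.Fbar ≃ₐ[T.F] AlgebraicClosure T.F := IsAlgClosure.equiv T.F T.Fbar (AlgebraicClosure T.F)
  let ψ : T.K →ₐ[T.F] AlgebraicClosure T.F :=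
    (ι : T.Fbar →ₐ[T.F] AlgebraicClosure T.F).comp (IsScalarTower.toAlgHom T.F T.K T.Fbar)
  have hK : (T.E.galoisRepTorsion (l : ℤ)).ker ≤ ψ.fieldRange.fixingSubgroup :=
    Cor22.ker_galoisRepTorsion_le_fixingSubgroup_of_initialThetaData T.D ι
  have hss : T.E.IsSemistable (𝓞 T.F) := T.D.isSemistable
  have hKF : Module.finrank T.F T.K ∣ l * (l - 1) ^ 2 * (l + 1) := Cor22.finrank_dvd_of_ker_le ψ hK
  obtain ⟨k, hk⟩ := Cor22.exists_ramificationIdx_eq_pow_of_ker_le ψ hss T.j_eq hl hK w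
    (Cor22.natCast_notMem_finBelow_of_residueChar_ne hl w hwl)
  exact ramificationIdx_dvd_prime_of_eq_pow w hl hk hKF

/-- **`e(w|p) = e(v₀|p)·e(v|v₀)·e(w|v)`** along `ℤ ⊆ 𝓞_{F_tpd} ⊆ 𝓞_F ⊆ 𝓞_K` for every place `w` of `K` (`v = w ∩ F`,
`v₀ = v ∩ F_tpd`; abc-iut-w5-d009's `ThetaData.absRamificationIdx_eq_ramIdx_mul` twice). [cite: NeukirchANT1999, Ch. II Prop. (6.8)] -/
theorem GenuineK.ramificationIdx_int_eq_mul_of_place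
    (w : letI := T.instFieldK; letI := T.instNumberFieldK; HeightOneSpectrum (𝓞 T.K)) :
    letI := T.instFieldF; letI := T.instNumberFieldF; letI := T.instAlgebraF; letI := T.instFieldK
    letI := T.instNumberFieldK; letI := T.instAlgebraK
    w.asIdeal.ramificationIdx ℤ =
      ramIdx P.F (finBelow P.F T.F (finBelow T.F T.K w)) *
        (finBelow T.F T.K w).asIdeal.ramificationIdx (𝓞 P.F) * w.asIdeal.ramificationIdx (𝓞 T.F) := by
  letI := T.instFieldF; letI := T.instNumberFieldF; letI := T.instAlgebraF; letI := T.instFieldK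
  letI := T.instNumberFieldK; letI := T.instAlgebraK
  set v : HeightOneSpectrum (𝓞 T.F) := finBelow T.F T.K w with hvdef
  set v₀ : HeightOneSpectrum (𝓞 P.F) := finBelow P.F T.F v with hv₀def
  have hw_under : w.under (𝓞 T.F) = v := rfl
  have hv_under : v.under (𝓞 P.F) = v₀ := rfl
  haveI : v.asIdeal.IsMaximal := v.isMaximal
  haveI : v₀.asIdeal.IsMaximal := v₀.isMaximal
  rw [ThetaData.absRamificationIdx_eq_ramIdx_mul (F := T.F) w, hw_under, ramIdx_eq,
    ThetaData.absRamificationIdx_eq_ramIdx_mul (F := P.F) v, hv_under,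
    Ideal.ramificationIdx'_eq_ramificationIdx v.asIdeal w.asIdeal v.ne_bot,
    Ideal.ramificationIdx'_eq_ramificationIdx v₀.asIdeal v.asIdeal v₀.ne_bot]

/-- **ABSOLUTE TAMENESS at EVERY place over `p ∉ {2, 3, 5, l}`.** For a genuine Θ-volume datum `T` at `(P, l)` with `λ ∈ U_X`,
a prime `p ∉ {2, 3, 5}`, `p ≠ l`, and ANY place `w | p` of `K = T.K` whose place `v₀ = w ∩ F_tpd` below has `p ∤ e(v₀|p)`:
**`p ∤ e(w|p)`** — `e(w|p) = e(v₀|p)·e(v|v₀)·e(w|v)` with `p ∤ e(v|v₀)` (`F/F_tpd` tame away from `{2,3,5}`) and `p ∤ e(w|v)`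
(`K/F`: `e = 1` over good places of `λ`, `p ∤ e` over bad ones, `w ∤ l`), all from `Cor22.ThetaVolumeDatumAt.towerFacts`.
[cite: Mochizuki2012, IUTchIV Thm. 1.10 Steps (ii)–(iii) p. 24–26] [cite: NeukirchANT1999, Ch. II Prop. (6.8)] -/
theorem GenuineK.not_dvd_ramificationIdx_int_of_place (hU : P.InU) (pp : Nat.Primes)
    (hp2 : (pp : ℕ) ≠ 2) (hp3 : (pp : ℕ) ≠ 3) (hp5 : (pp : ℕ) ≠ 5) (hpl : (pp : ℕ) ≠ l)
    (w : letI := T.instFieldK; letI := T.instNumberFieldK; HeightOneSpectrum (𝓞 T.K))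
    (hpw : letI := T.instFieldK; letI := T.instNumberFieldK; ((pp : ℕ) : 𝓞 T.K) ∈ w.asIdeal)
    (hbase : letI := T.instFieldF; letI := T.instNumberFieldF; letI := T.instAlgebraF; letI := T.instFieldK
      letI := T.instNumberFieldK; letI := T.instAlgebraK
      ¬ (pp : ℕ) ∣ ramIdx P.F (finBelow P.F T.F (finBelow T.F T.K w))) :
    letI := T.instFieldK; letI := T.instNumberFieldK
    ¬ (pp : ℕ) ∣ w.asIdeal.ramificationIdx ℤ := by
  letI := T.instFieldF; letI := T.instNumberFieldF; letI := T.instAlgebraF; letI := T.instFieldK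
  letI := T.instNumberFieldK; letI := T.instAlgebraK; letI := T.instFieldFbar; letI := T.instAlgebraFbar
  letI := T.instAlgebraKFbar; letI := T.instIsElliptic
  haveI : Fact (pp : ℕ).Prime := ⟨pp.2⟩
  obtain ⟨-, -, -, -, -, hKgood, hKbad, -, hFtame⟩ := T.towerFacts hU
  set v : HeightOneSpectrum (𝓞 T.F) := finBelow T.F T.K w with hvdef
  have hpv : ((pp : ℕ) : 𝓞 T.F) ∈ v.asIdeal := by
    change ((pp : ℕ) : 𝓞 T.F) ∈ w.asIdeal.under (𝓞 T.F)
    rw [Ideal.under_def, Ideal.mem_comap, map_natCast]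
    exact hpw
  have hwchar : residueChar T.K w = (pp : ℕ) := residueChar_eq_of_natCast_mem pp.1 hpw
  have hvchar : residueChar T.F v = (pp : ℕ) := residueChar_eq_of_natCast_mem pp.1 hpv
  -- the `K/F` layer: `p ∤ e(w|v)` (good places: `e = 1`; bad places: `towerFacts` (vii))
  have htameK : ¬ (pp : ℕ) ∣ w.asIdeal.ramificationIdx (𝓞 T.F) := by
    have hwl : residueChar T.K w ≠ l := by rw [hwchar]; exact hpl
    by_cases hbad : finBelow P.F T.F (finBelow T.F T.K w) ∈ Cor22.badPlaces P
    · have h := hKbad w hwl hbad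
      rwa [hwchar] at h
    · rw [hKgood w hwl hbad, Nat.dvd_one]
      exact pp.2.ne_one
  -- the `F/F_tpd` layer: `p ∤ e(v|v₀)` (`towerFacts` (ix))
  have htameF : ¬ (pp : ℕ) ∣ v.asIdeal.ramificationIdx (𝓞 P.F) := by
    have h := hFtame v (by
      rw [hvchar]
      simp only [Finset.mem_insert, Finset.mem_singleton, not_or]
      exact ⟨hp2, hp3, hp5⟩)
    rwa [hvchar] at h
  rw [GenuineK.ramificationIdx_int_eq_mul_of_place T w]
  intro h
  rcases (Nat.Prime.dvd_mul pp.2).1 h with h12 | h3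
  · rcases (Nat.Prime.dvd_mul pp.2).1 h12 with h1 | h2
    · exact hbase h1
    · exact htameF h2
  · exact htameK h3

/-- **`e(w|p) ≤ e(v₀|p)·46080·l` at EVERY place `w | p` of `K`, `p ∉ {2, l}`** (`v₀ = w ∩ F_tpd`): `e(v|v₀) ≤ 46080` at the
odd place `v₀` (abc-iut-S1's two-root lemma for the layer `F_tpd ⊆ F ⊆ F_tpd(√−1, √λ, √(λ−1), E_λ[15])`, Step (ii)) and
`e(w|v) ∣ l` (`GenuineK.ramificationIdx_rel_dvd_of_place`). The ∃-form of abc-iut-c312-7 bounds the last layer by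
`[K:F] ≤ l(l−1)²(l+1)`; this is the SHARP layer budget of Step (iii) (R2) at every place.
[cite: Mochizuki2012, IUTchIV Thm. 1.10 Steps (ii)–(iii) (R2) p. 24–25] [cite: NeukirchANT1999, Ch. II Prop. (6.8)] -/
theorem GenuineK.ramificationIdx_int_le_of_place (hU : P.InU) (pp : Nat.Primes) (hp2 : (pp : ℕ) ≠ 2) (hpl : (pp : ℕ) ≠ l)
    (w : letI := T.instFieldK; letI := T.instNumberFieldK; HeightOneSpectrum (𝓞 T.K))
    (hpw : letI := T.instFieldK; letI := T.instNumberFieldK; ((pp : ℕ) : 𝓞 T.K) ∈ w.asIdeal) :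
    letI := T.instFieldF; letI := T.instNumberFieldF; letI := T.instAlgebraF; letI := T.instFieldK
    letI := T.instNumberFieldK; letI := T.instAlgebraK
    w.asIdeal.ramificationIdx ℤ ≤ ramIdx P.F (finBelow P.F T.F (finBelow T.F T.K w)) * 46080 * l := by
  letI := T.instFieldF; letI := T.instNumberFieldF; letI := T.instAlgebraF; letI := T.instFieldK
  letI := T.instNumberFieldK; letI := T.instAlgebraK; letI := T.instFieldFbar; letI := T.instAlgebraFbar
  letI := T.instAlgebraKFbar; letI := T.instIsElliptic
  haveI : Fact (pp : ℕ).Prime := ⟨pp.2⟩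
  have hl : l.Prime := T.D.l_prime
  obtain ⟨hGalF, -, -, -, -, -, -, -, -⟩ := T.towerFacts hU
  haveI := hGalF
  set v : HeightOneSpectrum (𝓞 T.F) := finBelow T.F T.K w with hvdef
  set v₀ : HeightOneSpectrum (𝓞 P.F) := finBelow P.F T.F v with hv₀def
  have hpv : ((pp : ℕ) : 𝓞 T.F) ∈ v.asIdeal := by
    change ((pp : ℕ) : 𝓞 T.F) ∈ w.asIdeal.under (𝓞 T.F)
    rw [Ideal.under_def, Ideal.mem_comap, map_natCast]
    exact hpw
  have hpv₀ : ((pp : ℕ) : 𝓞 P.F) ∈ v₀.asIdeal := by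
    change ((pp : ℕ) : 𝓞 P.F) ∈ v.asIdeal.under (𝓞 P.F)
    rw [Ideal.under_def, Ideal.mem_comap, map_natCast]
    exact hpv
  have hwchar : residueChar T.K w = (pp : ℕ) := residueChar_eq_of_natCast_mem pp.1 hpw
  -- `e(v|v₀) ≤ 46080` (two-root lemma; `v₀ ∤ 2`)
  have hevv₀le : v.asIdeal.ramificationIdx (𝓞 P.F) ≤ 46080 := by
    refine Cor22.ramificationIdx_subThetaField_le T.F hU T.isSubThetaField v ?_
    intro h2
    exact hp2 (eq_of_natCast_mem_of_prime pp.1 v₀.isPrime.ne_top Nat.prime_two h2 hpv₀).symm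
  -- `e(w|v) ≤ l`
  have hewvle : w.asIdeal.ramificationIdx (𝓞 T.F) ≤ l :=
    Nat.le_of_dvd hl.pos (GenuineK.ramificationIdx_rel_dvd_of_place T w (by rw [hwchar]; exact hpl))
  rw [GenuineK.ramificationIdx_int_eq_mul_of_place T w]
  exact Nat.mul_le_mul (Nat.mul_le_mul le_rfl hevv₀le) hewvle

/-- **`e(w|p) ∣ e(v₀|p)·(2¹²·3²·5)·l` at EVERY place `w | p` of `K`, `p ≠ l`**: `e(v|v₀) ∣ [F:F_tpd] ∣ 2¹²·3²·5` (`F/F_tpd`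
Galois: `e ∣ [F:F_tpd]`, Neukirch I (9.3); `[F:F_tpd] ∣ 2¹²·3²·5`, the cell's reading v3 of Step (ii)
"`Gal(F/F_tpd) ↪ GL₂(𝔽₃)×GL₂(𝔽₅)×ℤ/2ℤ`", `Cor22.ThetaVolumeDatumAt.finrank_tpd_F_dvd`) and `e(w|v) ∣ l`.
[cite: Mochizuki2012, IUTchIV Thm. 1.10 Step (ii) p. 24] [cite: NeukirchANT1999, Ch. I §9 Prop. (9.3)] -/
theorem GenuineK.ramificationIdx_int_dvd_of_place (hU : P.InU) (pp : Nat.Primes) (hpl : (pp : ℕ) ≠ l)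
    (w : letI := T.instFieldK; letI := T.instNumberFieldK; HeightOneSpectrum (𝓞 T.K))
    (hpw : letI := T.instFieldK; letI := T.instNumberFieldK; ((pp : ℕ) : 𝓞 T.K) ∈ w.asIdeal) :
    letI := T.instFieldF; letI := T.instNumberFieldF; letI := T.instAlgebraF; letI := T.instFieldK
    letI := T.instNumberFieldK; letI := T.instAlgebraK
    w.asIdeal.ramificationIdx ℤ ∣ ramIdx P.F (finBelow P.F T.F (finBelow T.F T.K w)) * (2 ^ 12 * 3 ^ 2 * 5) * l := by
  letI := T.instFieldF; letI := T.instNumberFieldF; letI := T.instAlgebraF; letI := T.instFieldK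
  letI := T.instNumberFieldK; letI := T.instAlgebraK; letI := T.instFieldFbar; letI := T.instAlgebraFbar
  letI := T.instAlgebraKFbar; letI := T.instIsElliptic
  haveI : Fact (pp : ℕ).Prime := ⟨pp.2⟩
  obtain ⟨hGalF, -, -, -, -, -, -, -, -⟩ := T.towerFacts hU
  haveI := hGalF
  set v : HeightOneSpectrum (𝓞 T.F) := finBelow T.F T.K w with hvdef
  set v₀ : HeightOneSpectrum (𝓞 P.F) := finBelow P.F T.F v with hv₀def
  have hwchar : residueChar T.K w = (pp : ℕ) := residueChar_eq_of_natCast_mem pp.1 hpw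
  haveI : v₀.asIdeal.IsMaximal := v₀.isMaximal
  -- `e(v|v₀) ∣ [F : F_tpd] ∣ 2^12·3^2·5`
  have hevv₀dvd : v.asIdeal.ramificationIdx (𝓞 P.F) ∣ 2 ^ 12 * 3 ^ 2 * 5 :=
    (ramificationIdx_dvd_finrank_of_isGalois (F := P.F) (E := T.F) v₀.asIdeal v.asIdeal).trans T.finrank_tpd_F_dvd
  -- `e(w|v) ∣ l`
  have hewvdvd : w.asIdeal.ramificationIdx (𝓞 T.F) ∣ l :=
    GenuineK.ramificationIdx_rel_dvd_of_place T w (by rw [hwchar]; exact hpl)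
  rw [GenuineK.ramificationIdx_int_eq_mul_of_place T w]
  exact Nat.mul_dvd_mul (Nat.mul_dvd_mul (dvd_refl _) hevv₀dvd) hewvdvd

/-! ## §2. Completion level: the rescaled completion `K_w = kOf (pilotDataOfK T.D T.K) p x₀` at EVERY fibre point `x₀ | p` -/

/-- `e(K_w/ℚ_p) = e(w|p)` for the rescaled completion at `w = placeOf x₀` (abc-iut-S7's `absRamificationIdx_rescaledCompletion`).
[cite: NeukirchANT1999, Ch. II Prop. (6.8)] -/
theorem GenuineK.absRamificationIdx_kOf_eq (pp : Nat.Primes)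
    (x₀ : letI := T.instFieldF; letI := T.instNumberFieldF; letI := T.instAlgebraF; letI := T.instFieldK
      letI := T.instNumberFieldK; letI := T.instAlgebraK; letI := T.instFieldFbar; letI := T.instAlgebraFbar
      letI := T.instAlgebraKFbar; letI := T.instIsElliptic
      (thetaIndex (pilotDataOfK T.D T.K)).Fibre (.inr pp)) :
    letI := T.instFieldF; letI := T.instNumberFieldF; letI := T.instAlgebraF; letI := T.instFieldK
    letI := T.instNumberFieldK; letI := T.instAlgebraK; letI := T.instFieldFbar; letI := T.instAlgebraFbar
    letI := T.instAlgebraKFbar; letI := T.instIsElliptic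
    haveI : Fact (pp : ℕ).Prime := ⟨pp.2⟩
    absRamificationIdx (pp : ℕ) (kOf (pilotDataOfK T.D T.K) pp.1 x₀) =
      (placeOf (pilotDataOfK T.D T.K) pp.1 x₀).asIdeal.ramificationIdx ℤ := by
  letI := T.instFieldF; letI := T.instNumberFieldF; letI := T.instAlgebraF; letI := T.instFieldK
  letI := T.instNumberFieldK; letI := T.instAlgebraK; letI := T.instFieldFbar; letI := T.instAlgebraFbar
  letI := T.instAlgebraKFbar; letI := T.instIsElliptic
  haveI : Fact (pp : ℕ).Prime := ⟨pp.2⟩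
  have hpx : ((pp : ℕ) : 𝓞 T.K) ∈ (placeOf (pilotDataOfK T.D T.K) pp.1 x₀).asIdeal :=
    natCast_mem_placeOf (pilotDataOfK T.D T.K) pp.1 x₀
  rw [show absRamificationIdx (pp : ℕ) (kOf (pilotDataOfK T.D T.K) pp.1 x₀) =
      absRamificationIdx (pp : ℕ) (RescaledCompletion T.K pp.1 (placeOf (pilotDataOfK T.D T.K) pp.1 x₀) hpx) from rfl,
    absRamificationIdx_rescaledCompletion]

/-- **`p ∤ e(K_w/ℚ_p)` at EVERY fibre point `x₀ | p`** of the index of the `K`-level pilot datum, `p ∉ {2, 3, 5, l}`, under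
`p ∤ e(v₀|p)` at `v₀ = w ∩ F_tpd` (`w = placeOf x₀`): the completion `K_w` is ABSOLUTELY TAMELY ramified.
[cite: Mochizuki2012, IUTchIV Thm. 1.10 Steps (ii)–(iii) p. 24–26] [cite: SerreLocalFields1979, Ch. III §6 Prop. 13] -/
theorem GenuineK.not_dvd_absRamificationIdx_kOf (hU : P.InU) (pp : Nat.Primes)
    (hp2 : (pp : ℕ) ≠ 2) (hp3 : (pp : ℕ) ≠ 3) (hp5 : (pp : ℕ) ≠ 5) (hpl : (pp : ℕ) ≠ l)
    (x₀ : letI := T.instFieldF; letI := T.instNumberFieldF; letI := T.instAlgebraF; letI := T.instFieldK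
      letI := T.instNumberFieldK; letI := T.instAlgebraK; letI := T.instFieldFbar; letI := T.instAlgebraFbar
      letI := T.instAlgebraKFbar; letI := T.instIsElliptic
      (thetaIndex (pilotDataOfK T.D T.K)).Fibre (.inr pp))
    (hbase : letI := T.instFieldF; letI := T.instNumberFieldF; letI := T.instAlgebraF; letI := T.instFieldK
      letI := T.instNumberFieldK; letI := T.instAlgebraK; letI := T.instFieldFbar; letI := T.instAlgebraFbar
      letI := T.instAlgebraKFbar; letI := T.instIsElliptic
      haveI : Fact (pp : ℕ).Prime := ⟨pp.2⟩
      ¬ (pp : ℕ) ∣ ramIdx P.F (finBelow P.F T.F (finBelow T.F T.K (placeOf (pilotDataOfK T.D T.K) pp.1 x₀)))) :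
    letI := T.instFieldF; letI := T.instNumberFieldF; letI := T.instAlgebraF; letI := T.instFieldK
    letI := T.instNumberFieldK; letI := T.instAlgebraK; letI := T.instFieldFbar; letI := T.instAlgebraFbar
    letI := T.instAlgebraKFbar; letI := T.instIsElliptic
    haveI : Fact (pp : ℕ).Prime := ⟨pp.2⟩
    ¬ (pp : ℕ) ∣ absRamificationIdx (pp : ℕ) (kOf (pilotDataOfK T.D T.K) pp.1 x₀) := by
  letI := T.instFieldF; letI := T.instNumberFieldF; letI := T.instAlgebraF; letI := T.instFieldK
  letI := T.instNumberFieldK; letI := T.instAlgebraK; letI := T.instFieldFbar; letI := T.instAlgebraFbar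
  letI := T.instAlgebraKFbar; letI := T.instIsElliptic
  haveI : Fact (pp : ℕ).Prime := ⟨pp.2⟩
  rw [GenuineK.absRamificationIdx_kOf_eq T pp x₀]
  exact GenuineK.not_dvd_ramificationIdx_int_of_place T hU pp hp2 hp3 hp5 hpl _
    (natCast_mem_placeOf (pilotDataOfK T.D T.K) pp.1 x₀) hbase

/-- **`e(K_w/ℚ_p) ≤ e(v₀|p)·46080·l` at EVERY fibre point `x₀ | p`**, `p ∉ {2, l}`.
[cite: Mochizuki2012, IUTchIV Thm. 1.10 Steps (ii)–(iii) (R2) p. 24–25] -/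
theorem GenuineK.absRamificationIdx_kOf_le (hU : P.InU) (pp : Nat.Primes) (hp2 : (pp : ℕ) ≠ 2) (hpl : (pp : ℕ) ≠ l)
    (x₀ : letI := T.instFieldF; letI := T.instNumberFieldF; letI := T.instAlgebraF; letI := T.instFieldK
      letI := T.instNumberFieldK; letI := T.instAlgebraK; letI := T.instFieldFbar; letI := T.instAlgebraFbar
      letI := T.instAlgebraKFbar; letI := T.instIsElliptic
      (thetaIndex (pilotDataOfK T.D T.K)).Fibre (.inr pp)) :
    letI := T.instFieldF; letI := T.instNumberFieldF; letI := T.instAlgebraF; letI := T.instFieldK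
    letI := T.instNumberFieldK; letI := T.instAlgebraK; letI := T.instFieldFbar; letI := T.instAlgebraFbar
    letI := T.instAlgebraKFbar; letI := T.instIsElliptic
    haveI : Fact (pp : ℕ).Prime := ⟨pp.2⟩
    absRamificationIdx (pp : ℕ) (kOf (pilotDataOfK T.D T.K) pp.1 x₀) ≤
      ramIdx P.F (finBelow P.F T.F (finBelow T.F T.K (placeOf (pilotDataOfK T.D T.K) pp.1 x₀))) * 46080 * l := by
  letI := T.instFieldF; letI := T.instNumberFieldF; letI := T.instAlgebraF; letI := T.instFieldK
  letI := T.instNumberFieldK; letI := T.instAlgebraK; letI := T.instFieldFbar; letI := T.instAlgebraFbar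
  letI := T.instAlgebraKFbar; letI := T.instIsElliptic
  haveI : Fact (pp : ℕ).Prime := ⟨pp.2⟩
  rw [GenuineK.absRamificationIdx_kOf_eq T pp x₀]
  exact GenuineK.ramificationIdx_int_le_of_place T hU pp hp2 hpl _ (natCast_mem_placeOf (pilotDataOfK T.D T.K) pp.1 x₀)

/-- **`d(K_w) = (e − 1)/e` EXACTLY at EVERY fibre point `x₀ | p`**, `p ∉ {2, 3, 5, l}`, base tame: the different of an
absolutely tamely ramified `p`-adic field (Serre, *Local Fields* III §6 Prop. 13; the tree's `differentOrd_eq_of_not_dvd`).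
This is the WINDOW-TABLE column `d_w` as a kernel identity for every packet over such `p`.
[cite: SerreLocalFields1979, Ch. III §6 Prop. 13] [cite: Mochizuki2012, IUTchIV Prop. 1.1 p. 9] -/
theorem GenuineK.differentOrd_kOf_eq (hU : P.InU) (pp : Nat.Primes)
    (hp2 : (pp : ℕ) ≠ 2) (hp3 : (pp : ℕ) ≠ 3) (hp5 : (pp : ℕ) ≠ 5) (hpl : (pp : ℕ) ≠ l)
    (x₀ : letI := T.instFieldF; letI := T.instNumberFieldF; letI := T.instAlgebraF; letI := T.instFieldK
      letI := T.instNumberFieldK; letI := T.instAlgebraK; letI := T.instFieldFbar; letI := T.instAlgebraFbar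
      letI := T.instAlgebraKFbar; letI := T.instIsElliptic
      (thetaIndex (pilotDataOfK T.D T.K)).Fibre (.inr pp))
    (hbase : letI := T.instFieldF; letI := T.instNumberFieldF; letI := T.instAlgebraF; letI := T.instFieldK
      letI := T.instNumberFieldK; letI := T.instAlgebraK; letI := T.instFieldFbar; letI := T.instAlgebraFbar
      letI := T.instAlgebraKFbar; letI := T.instIsElliptic
      haveI : Fact (pp : ℕ).Prime := ⟨pp.2⟩
      ¬ (pp : ℕ) ∣ ramIdx P.F (finBelow P.F T.F (finBelow T.F T.K (placeOf (pilotDataOfK T.D T.K) pp.1 x₀)))) :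
    letI := T.instFieldF; letI := T.instNumberFieldF; letI := T.instAlgebraF; letI := T.instFieldK
    letI := T.instNumberFieldK; letI := T.instAlgebraK; letI := T.instFieldFbar; letI := T.instAlgebraFbar
    letI := T.instAlgebraKFbar; letI := T.instIsElliptic
    haveI : Fact (pp : ℕ).Prime := ⟨pp.2⟩
    differentOrd (pp : ℕ) (kOf (pilotDataOfK T.D T.K) pp.1 x₀) =
      ((absRamificationIdx (pp : ℕ) (kOf (pilotDataOfK T.D T.K) pp.1 x₀) : ℝ) - 1) /
        absRamificationIdx (pp : ℕ) (kOf (pilotDataOfK T.D T.K) pp.1 x₀) := by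
  letI := T.instFieldF; letI := T.instNumberFieldF; letI := T.instAlgebraF; letI := T.instFieldK
  letI := T.instNumberFieldK; letI := T.instAlgebraK; letI := T.instFieldFbar; letI := T.instAlgebraFbar
  letI := T.instAlgebraKFbar; letI := T.instIsElliptic
  haveI : Fact (pp : ℕ).Prime := ⟨pp.2⟩
  exact differentOrd_eq_of_not_dvd (pp : ℕ) _ (GenuineK.not_dvd_absRamificationIdx_kOf T hU pp hp2 hp3 hp5 hpl x₀ hbase)

/-- **`d + a + b ≤ 2 + log(e(v₀|p)·46080·l)/log p` at EVERY fibre point `x₀ | p`**, `p ∉ {2, 3, 5, l}` (so `p ≥ 7`), base tame: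
abc-iut-c312-7's tame constant bound `Cor312Prov.differentOrd_add_logRadius_le_of_not_dvd` (`d + a + b ≤ 2 + log e/log p`) with the
∀-place ramification bound. The per-factor [IUTchIV] Prop. 1.1/1.2 exponent of the explicit depth inequality of
`Conditional.GenuineK.not_pilotKummerCompatHull_chosen_of_explicit_depth` — at every place over `p`, not one.
[cite: Mochizuki2012, IUTchIV Prop. 1.2 p. 10, Thm. 1.10 Steps (ii)–(iii) p. 24–26] [claim: Mochizuki2012, status: disputed] -/
theorem GenuineK.depthConstants_kOf_le (hU : P.InU) (pp : Nat.Primes)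
    (hp2 : (pp : ℕ) ≠ 2) (hp3 : (pp : ℕ) ≠ 3) (hp5 : (pp : ℕ) ≠ 5) (hpl : (pp : ℕ) ≠ l)
    (x₀ : letI := T.instFieldF; letI := T.instNumberFieldF; letI := T.instAlgebraF; letI := T.instFieldK
      letI := T.instNumberFieldK; letI := T.instAlgebraK; letI := T.instFieldFbar; letI := T.instAlgebraFbar
      letI := T.instAlgebraKFbar; letI := T.instIsElliptic
      (thetaIndex (pilotDataOfK T.D T.K)).Fibre (.inr pp))
    (hbase : letI := T.instFieldF; letI := T.instNumberFieldF; letI := T.instAlgebraF; letI := T.instFieldK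
      letI := T.instNumberFieldK; letI := T.instAlgebraK; letI := T.instFieldFbar; letI := T.instAlgebraFbar
      letI := T.instAlgebraKFbar; letI := T.instIsElliptic
      haveI : Fact (pp : ℕ).Prime := ⟨pp.2⟩
      ¬ (pp : ℕ) ∣ ramIdx P.F (finBelow P.F T.F (finBelow T.F T.K (placeOf (pilotDataOfK T.D T.K) pp.1 x₀)))) :
    letI := T.instFieldF; letI := T.instNumberFieldF; letI := T.instAlgebraF; letI := T.instFieldK
    letI := T.instNumberFieldK; letI := T.instAlgebraK; letI := T.instFieldFbar; letI := T.instAlgebraFbar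
    letI := T.instAlgebraKFbar; letI := T.instIsElliptic
    haveI : Fact (pp : ℕ).Prime := ⟨pp.2⟩
    differentOrd (pp : ℕ) (kOf (pilotDataOfK T.D T.K) pp.1 x₀)
        + logRadiusA (pp : ℕ) (absRamificationIdx (pp : ℕ) (kOf (pilotDataOfK T.D T.K) pp.1 x₀))
        + logRadiusB (pp : ℕ) (absRamificationIdx (pp : ℕ) (kOf (pilotDataOfK T.D T.K) pp.1 x₀)) ≤
      2 + Real.log ((ramIdx P.F (finBelow P.F T.F (finBelow T.F T.K (placeOf (pilotDataOfK T.D T.K) pp.1 x₀))) * 46080 * l : ℕ) : ℝ) /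
        Real.log (pp : ℕ) := by
  letI := T.instFieldF; letI := T.instNumberFieldF; letI := T.instAlgebraF; letI := T.instFieldK
  letI := T.instNumberFieldK; letI := T.instAlgebraK; letI := T.instFieldFbar; letI := T.instAlgebraFbar
  letI := T.instAlgebraKFbar; letI := T.instIsElliptic
  haveI : Fact (pp : ℕ).Prime := ⟨pp.2⟩
  have hp5' : 5 ≤ (pp : ℕ) := by
    have h2 := pp.2.two_le
    have h4 : (pp : ℕ) ≠ 4 := fun h4 => by
      have h := pp.2
      rw [h4] at h
      exact absurd h (by decide)
    omega
  have htame := GenuineK.not_dvd_absRamificationIdx_kOf T hU pp hp2 hp3 hp5 hpl x₀ hbase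
  have h1 := differentOrd_add_logRadius_le_of_not_dvd (pp : ℕ) (kOf (pilotDataOfK T.D T.K) pp.1 x₀) hp5' htame
  have hle := GenuineK.absRamificationIdx_kOf_le T hU pp hp2 hpl x₀
  have he : 0 < absRamificationIdx (pp : ℕ) (kOf (pilotDataOfK T.D T.K) pp.1 x₀) := absRamificationIdx_pos _ _
  have hlogp : 0 < Real.log (pp : ℕ) := Real.log_pos (by exact_mod_cast pp.2.one_lt)
  have hlog : Real.log (absRamificationIdx (pp : ℕ) (kOf (pilotDataOfK T.D T.K) pp.1 x₀)) ≤
      Real.log ((ramIdx P.F (finBelow P.F T.F (finBelow T.F T.K (placeOf (pilotDataOfK T.D T.K) pp.1 x₀))) * 46080 * l : ℕ) : ℝ) :=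
    Real.log_le_log (by exact_mod_cast he) (by exact_mod_cast hle)
  have := div_le_div_of_nonneg_right hlog hlogp.le
  linarith

end Summit.ABC.IUTFork.Conditional

end
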